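import Summits.BirchSwinnertonDyer.BirchSwinnertonDyer.Theorems.Rank2Observatory2DescZ2QuadField
import Summits.BirchSwinnertonDyer.BirchSwinnertonDyer.Theorems.Rank2Observatory2DescPIDCert
import Summits.BirchSwinnertonDyer.BirchSwinnertonDyer.Theorems.Rank2Observatory2DescLinGens
import Mathlib.RingTheory.Ideal.Int
import HarnessLib

/-!
# BirchSwinnertonDyer — rank ≥ 2 observatory: signature and class number one by certificate for real quadratic fields

HONEST FRAMING: per-curve certified theorems and census instruments; no claim on BSD in rank ≥ 2.

Generic piece of the successor instrument KERNEL-2DESC-Z2 (spec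
`code/b2b-bsdr2-cert-3/kernel-2desc-z2/README-Z2.md`), the quadratic twin of the cubic
instrument's `…2DescSignature.lean` / `…2DescPIDCertB.lean` / `…2DescLinGens.lean`: for
`K = ℚ(θ)`, `θ² + aθ + b = 0`, `f` irreducible, `[K : ℚ] = 2`:

* SIGNATURE: `Δ(f) = a² − 4b > 0 ⇒ (r₁, r₂) = (2, 0)`, unit rank `1`, a real embedding exists;
* MINKOWSKI: for a totally real quadratic field the Minkowski constant is `√d_K / 2`, so it is `< b`
  as soon as `d_K < 4b²` (`minkowskiBound_lt₂`);
* the TWO CASES for a prime ideal `I` over `p`: `absNorm I = p` or `I = (p)` (`exists_under_cases₂`);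
* CLASS NUMBER ONE BY DEGREE-ONE CERTIFICATES below the bound (`isPrincipalIdealRing_of_cert_lt₂`):
  if for every prime `p < b` every ring map `𝓞 K → ℤ/p` kills some prime element, `𝓞 K` is a PID;
* the elements `lin hθ p q = p + qθ ∈ 𝓞 K`, their norm `p² − apq + bq²`, primality when that norm is
  `±ℓ` (`lin_prime_of_prime₂`), and the certificate helpers `cert_of_no_root₂` / `cert_of_cases₂`.

Sorry-free; axioms `propext`, `Classical.choice`, `Quot.sound`.
[cite: Marcus2018, Ch. 2 (signature), Ch. 3 Thm. 22 (prime norms), Ch. 5 Cor. 2 of Thm. 37 (Minkowski)]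
-/

-- single-conjunct summit: `Summit.BirchSwinnertonDyer.BirchSwinnertonDyer.…` repeats the name by design
set_option linter.dupNamespace false

noncomputable section

open scoped Classical NumberField Real nonZeroDivisors

open Literature.NumberTheory.NumberFields Polynomial Module NumberField NumberField.InfinitePlace Ideal Nat

namespace Summit.BirchSwinnertonDyer.BirchSwinnertonDyer.Rank2Observatory.TwoDescZ2

open TwoDescCubic

variable {K : Type*} [Field K] [NumberField K] {a b : ℤ} {θ : K}

/-! ## Signature of a real quadratic field -/

/-- A quadratic field has `r₂ ≤ 1` (`r₁ + 2r₂ = 2`). [folklore] -/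
theorem nrComplexPlaces_le_one₂ (h2 : finrank ℚ K = 2) : nrComplexPlaces K ≤ 1 := by
  have h := card_add_two_mul_card_eq_rank K
  omega

/-- **Real quadratic**: `Δ(f) > 0 ⇒ r₂ = 0`. [cite: Marcus2018, Ch. 2] -/
theorem nrComplexPlaces_eq_zero_of_disc_pos (hirr : Irreducible (MonicQuad.polyQ a b))
    (hθ : aeval θ (MonicQuad.poly a b) = 0) (h2 : finrank ℚ K = 2) (hpos : 0 < MonicQuad.disc a b) :
    nrComplexPlaces K = 0 := by
  have hd : 0 < NumberField.discr K := (MonicQuad.discr_pos_iff_disc_pos hirr hθ h2).mpr hpos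
  have hs := NumberField.sign_discr (K := K)
  rw [Int.sign_eq_one_of_pos hd] at hs
  have heven : Even (nrComplexPlaces K) := by
    by_contra hodd
    rw [Nat.not_even_iff_odd] at hodd
    rw [hodd.neg_one_pow] at hs
    norm_num at hs
  have h := card_add_two_mul_card_eq_rank K
  rw [h2] at h
  obtain ⟨k, hk⟩ := heven
  change nrRealPlaces K + 2 * nrComplexPlaces K = 2 at h
  omega

/-- **Real quadratic**: `Δ(f) > 0 ⇒ r₁ = 2`. [cite: Marcus2018, Ch. 2] -/
theorem nrRealPlaces_eq_two_of_disc_pos (hirr : Irreducible (MonicQuad.polyQ a b))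
    (hθ : aeval θ (MonicQuad.poly a b) = 0) (h2 : finrank ℚ K = 2) (hpos : 0 < MonicQuad.disc a b) :
    nrRealPlaces K = 2 := by
  have h := card_add_two_mul_card_eq_rank K
  rw [nrComplexPlaces_eq_zero_of_disc_pos hirr hθ h2 hpos, h2] at h
  change nrRealPlaces K + 2 * 0 = 2 at h
  omega

/-- **Real quadratic: unit rank one** (Dirichlet: `r₁ + r₂ − 1 = 1`). [cite: Marcus2018, Ch. 5] -/
theorem units_rank_eq_one_of_disc_pos (hirr : Irreducible (MonicQuad.polyQ a b))
    (hθ : aeval θ (MonicQuad.poly a b) = 0) (h2 : finrank ℚ K = 2) (hpos : 0 < MonicQuad.disc a b) :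
    NumberField.Units.rank K = 1 := by
  rw [NumberField.Units.rank, card_eq_nrRealPlaces_add_nrComplexPlaces,
    nrRealPlaces_eq_two_of_disc_pos hirr hθ h2 hpos, nrComplexPlaces_eq_zero_of_disc_pos hirr hθ h2 hpos]

/-- **A real embedding exists** when `Δ(f) > 0`. [folklore] -/
theorem exists_ringHom_real_of_disc_pos (hirr : Irreducible (MonicQuad.polyQ a b))
    (hθ : aeval θ (MonicQuad.poly a b) = 0) (h2 : finrank ℚ K = 2) (hpos : 0 < MonicQuad.disc a b) :
    Nonempty (K →+* ℝ) := by
  have h := nrRealPlaces_eq_two_of_disc_pos hirr hθ h2 hpos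
  have hne : Nonempty {w : InfinitePlace K // w.IsReal} := by
    rw [← Fintype.card_pos_iff]
    change 0 < nrRealPlaces K
    omega
  obtain ⟨⟨w, hw⟩⟩ := hne
  exact ⟨NumberField.InfinitePlace.embedding_of_isReal hw⟩

/-! ## Minkowski bound and class number one by certificate -/

/-- **Minkowski constant of a totally real quadratic field is `< b` when `d_K < 4b²`**:
`(2!/2²)·√d_K = √d_K / 2`. [cite: Marcus2018, Ch. 5, Cor. 2 of Thm. 37] -/
theorem minkowskiBound_lt₂ (h2 : finrank ℚ K = 2) (hc : nrComplexPlaces K = 0) {b : ℕ}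
    (hd : |discr K| < 4 * (b : ℤ) ^ 2) :
    (4 / π) ^ nrComplexPlaces K *
      ((finrank ℚ K)! / (finrank ℚ K) ^ (finrank ℚ K) * √|discr K|) < b := by
  rw [hc, h2, pow_zero, one_mul]
  have hY : ((2 : ℕ)! : ℝ) / ((2 : ℕ) : ℝ) ^ (2 : ℕ) = 1 / 2 := by norm_num [Nat.factorial]
  rw [hY]
  set s : ℝ := √|((discr K : ℤ) : ℝ)| with hs_def
  have hs0 : 0 ≤ s := Real.sqrt_nonneg _
  have hs2 : s ^ 2 = |((discr K : ℤ) : ℝ)| := Real.sq_sqrt (abs_nonneg _)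
  have hdR : |((discr K : ℤ) : ℝ)| < 4 * (b : ℝ) ^ 2 := by
    rw [← Int.cast_abs]; exact_mod_cast hd
  have hb0 : (0 : ℝ) ≤ 2 * b := by positivity
  have hsq : s ^ 2 < (2 * (b : ℝ)) ^ 2 := by nlinarith [hs2, hdR]
  have hkey : s < 2 * b := lt_of_pow_lt_pow_left₀ 2 hb0 hsq
  linarith

/-- **The two cases for a prime ideal of a quadratic ring of integers**: with `p` the prime under
`I`, either `absNorm I = p` or `I = (p)`. [cite: Marcus2018, Ch. 3, Thm. 21] -/
theorem exists_under_cases₂ (h2 : finrank ℚ K = 2) {I : Ideal (𝓞 K)} (hI : I.IsPrime) (hI0 : I ≠ ⊥) :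
    ∃ p : ℕ, p.Prime ∧ p ≤ absNorm I ∧ (absNorm I = p ∨ I = span {(p : 𝓞 K)}) := by
  haveI : NeZero I := ⟨hI0⟩
  haveI := hI
  set p : ℕ := absNorm (under ℤ I) with hp_def
  have hp : p.Prime := Nat.absNorm_under_prime I
  have hpI : (p : 𝓞 K) ∈ I := Int.absNorm_under_mem I
  obtain ⟨J, hJ⟩ : I ∣ span {(p : 𝓞 K)} :=
    Ideal.dvd_iff_le.mpr ((Ideal.span_singleton_le_iff_mem _).mpr hpI)
  have hNp : absNorm (span {(p : 𝓞 K)}) = p ^ 2 := by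
    rw [absNorm_span_singleton, Algebra.norm_natCast, RingOfIntegers.rank, h2]
    simp [Int.natAbs_pow]
  have hmul : p ^ 2 = absNorm I * absNorm J := by rw [← hNp, hJ, map_mul]
  obtain ⟨k, hk, hnk⟩ := (Nat.dvd_prime_pow hp).mp ⟨_, hmul⟩
  have h1 : absNorm I ≠ 1 := fun h => hI.ne_top (absNorm_eq_one_iff.mp h)
  have hp0 : p ≠ 0 := hp.ne_zero
  refine ⟨p, hp, ?_, ?_⟩
  · rw [hnk]
    interval_cases k
    · exact absurd (by simpa using hnk) h1
    all_goals exact Nat.le_self_pow (by norm_num) p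
  interval_cases k
  · exact absurd (by simpa using hnk) h1
  · exact Or.inl (by simpa using hnk)
  · refine Or.inr ?_
    have h := hmul
    rw [hnk] at h
    have hJ1 : J = ⊤ :=
      absNorm_eq_one_iff.mp (mul_left_cancel₀ (pow_ne_zero 2 hp0) (h.symm.trans (mul_one _).symm))
    rw [hJ1, Ideal.mul_top] at hJ
    exact hJ.symm

/-- **Class number one by degree-one certificates below the Minkowski bound** for a real quadratic
field `K = ℚ(θ)`, `f(θ) = 0`, `0 < Δ(f) < 4b²`: if for every prime `p < b` every ring map
`𝓞 K → ℤ/p` kills some prime element, then `𝓞 K` is a PID. [cite: Marcus2018, Ch. 5, Cor. 2 of Thm. 37] -/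
theorem isPrincipalIdealRing_of_cert_lt₂ (hirr : Irreducible (MonicQuad.polyQ a b))
    (hθ : aeval θ (MonicQuad.poly a b) = 0) (h2 : finrank ℚ K = 2) (hpos : 0 < MonicQuad.disc a b)
    {b' : ℕ} (hd : MonicQuad.disc a b < 4 * (b' : ℤ) ^ 2)
    (hcert : ∀ p : ℕ, p < b' → p.Prime → ∀ ψ : 𝓞 K →+* ZMod p, ∃ e : 𝓞 K, ψ e = 0 ∧ Prime e) :
    IsPrincipalIdealRing (𝓞 K) := by
  have hdK : |discr K| < 4 * (b' : ℤ) ^ 2 := by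
    have h1 := MonicQuad.abs_discr_le_abs_disc hirr hθ h2
    rw [abs_of_pos hpos] at h1
    exact lt_of_le_of_lt h1 hd
  have hM := minkowskiBound_lt₂ h2 (nrComplexPlaces_eq_zero_of_disc_pos hirr hθ h2 hpos) hdK
  refine RingOfIntegers.isPrincipalIdealRing_of_isPrincipal_of_norm_le_of_isPrime (fun I hI hIN => ?_)
  have hlt : absNorm (I : Ideal (𝓞 K)) < b' := by
    have : (absNorm (I : Ideal (𝓞 K)) : ℝ) < (b' : ℕ) := lt_of_le_of_lt hIN hM
    exact_mod_cast this
  have hI0 : (I : Ideal (𝓞 K)) ≠ ⊥ := nonZeroDivisors.coe_ne_zero I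
  obtain ⟨p, hp, hple, hcases⟩ := exists_under_cases₂ h2 hI hI0
  have hpb : p < b' := lt_of_le_of_lt hple hlt
  rcases hcases with hN | hIT
  · exact isPrincipal_of_absNorm_prime hI hp hN (hcert p hpb hp)
  · exact ⟨⟨p, by rw [hIT, Ideal.submodule_span_eq]⟩⟩

/-! ## The elements `p + qθ` and the certificate helpers -/

namespace MonicQuad

/-- The algebraic integer `p + qθ` of `K = ℚ(θ)`. [folklore] -/
def lin (hθ : aeval θ (poly a b) = 0) (p q : ℤ) : 𝓞 K := (p : 𝓞 K) + (q : 𝓞 K) * thetaInt hθ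

omit [NumberField K] in
/-- `lin` in `K`. [folklore] -/
theorem lin_coe (hθ : aeval θ (poly a b) = 0) (p q : ℤ) :
    ((lin hθ p q : 𝓞 K) : K) = (p : K) + (q : K) * θ := by
  simp only [lin, map_add, map_mul, map_intCast, coe_thetaInt]

omit [NumberField K] in
/-- `algebraMap` form of `lin_coe`. [folklore] -/
theorem algebraMap_lin (hθ : aeval θ (poly a b) = 0) (p q : ℤ) :
    algebraMap (𝓞 K) K (lin hθ p q) = (p : K) + (q : K) * θ := lin_coe hθ p q

/-- **Norm**: `N(p + qθ) = n`, read off the norm form `p² − apq + bq²`. [folklore] -/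
theorem norm_lin_eq (hirr : Irreducible (polyQ a b)) (hθ : aeval θ (poly a b) = 0)
    (h2 : finrank ℚ K = 2) (p q : ℤ) {n : ℤ} (hn : normForm a b p q = n) :
    Algebra.norm ℚ ((lin hθ p q : 𝓞 K) : K) = ((n : ℤ) : ℚ) := by
  rw [lin_coe, ← hn]
  have h := norm_lin hirr hθ h2 p q
  simpa only [Rat.cast_intCast] using h

/-- `|N_{K/ℚ}(p + qθ)| = |n|` down in `ℤ`. [folklore] -/
theorem natAbs_norm_lin (hirr : Irreducible (polyQ a b)) (hθ : aeval θ (poly a b) = 0)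
    (h2 : finrank ℚ K = 2) (p q : ℤ) {n : ℤ} (hn : normForm a b p q = n) :
    (Algebra.norm ℤ (lin hθ p q)).natAbs = n.natAbs :=
  natAbs_norm_eq_of_norm_eq (norm_lin_eq hirr hθ h2 p q hn)

/-- **Prime of degree one**: `|N(p + qθ)| = ℓ` prime `⇒ p + qθ` is a prime element.
[cite: Marcus2018, Ch. 3, Thm. 22] -/
theorem lin_prime_of_prime (hirr : Irreducible (polyQ a b)) (hθ : aeval θ (poly a b) = 0)
    (h2 : finrank ℚ K = 2) (p q : ℤ) {n : ℤ} (hn : normForm a b p q = n) (hp : n.natAbs.Prime) :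
    Prime (lin hθ p q) := by
  apply prime_of_natAbs_norm_prime
  rw [natAbs_norm_lin hirr hθ h2 p q hn]
  exact hp

/-- `lin hθ p q ≠ 0` unless `p = q = 0` (`1, θ` are `ℚ`-independent). [folklore] -/
theorem lin_ne_zero (hirr : Irreducible (polyQ a b)) (hθ : aeval θ (poly a b) = 0)
    (h2 : finrank ℚ K = 2) {p q : ℤ} (hne : p ≠ 0 ∨ q ≠ 0) : lin hθ p q ≠ 0 := by
  intro h
  have hK : (p : K) + (q : K) * θ = 0 := by
    have := congrArg (fun x : 𝓞 K => (x : K)) h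
    simpa only [lin_coe, map_zero] using this
  -- coordinates in the basis `1, θ`
  have hb := basis_apply hirr hθ h2
  have hrepr : (basis hirr hθ h2).repr ((p : K) + (q : K) * θ) =
      Finsupp.single 0 (p : ℚ) + Finsupp.single 1 (q : ℚ) := by
    have e0 : (p : K) = (p : ℚ) • basis hirr hθ h2 0 := by
      rw [hb, Fin.val_zero, pow_zero, Algebra.smul_def, mul_one, map_intCast]
    have e1 : (q : K) * θ = (q : ℚ) • basis hirr hθ h2 1 := by
      rw [hb, Fin.val_one, pow_one, Algebra.smul_def, map_intCast]
    rw [e0, e1, map_add, map_smul, map_smul, Basis.repr_self, Basis.repr_self,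
      Finsupp.smul_single_one, Finsupp.smul_single_one]
  rw [hK, map_zero] at hrepr
  have h0 := congrArg (fun f => f 0) hrepr
  have h1 := congrArg (fun f => f 1) hrepr
  simp only [Finsupp.coe_zero, Pi.zero_apply, Finsupp.coe_add, Pi.add_apply,
    Finsupp.single_eq_same, Finsupp.single_eq_of_ne (show (1 : Fin 2) ≠ 0 by decide),
    Finsupp.single_eq_of_ne (show (0 : Fin 2) ≠ 1 by decide), add_zero, zero_add] at h0 h1
  rcases hne with hp | hq
  · exact hp (by exact_mod_cast h0.symm)
  · exact hq (by exact_mod_cast h1.symm)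

/-- **Ring homomorphisms out of `𝓞 K = ℤ[θ]` from roots of `f`**: if `τ ∈ S` is a root of `f` in a
commutative ring `S`, there is a ring map `𝓞 K → S` with `θ ↦ τ` (`𝓞 K = ℤ[θ] ≅ ℤ[X]/(f)` under the
index condition, e.g. `Δ(f)` squarefree). Used for the residue maps `ψ_q : 𝓞 K → ℤ/q`.
[cite: Marcus2018, Ch. 3, Thm. 27] -/
theorem exists_ringHom_of_root (hirr : Irreducible (polyQ a b)) (hθ : aeval θ (poly a b) = 0)
    (h2 : finrank ℚ K = 2) (hsq : ∀ r e : ℤ, disc a b = r ^ 2 * e → 2 < |e| → IsUnit r)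
    {S : Type*} [CommRing S] (τ : S) (hτ : τ ^ 2 + (a : S) * τ + (b : S) = 0) :
    ∃ ψ : 𝓞 K →+* S, ψ (thetaInt hθ) = τ := by
  have hint : IsIntegral ℤ θ := isIntegral_of_aeval hθ
  have hev : (minpoly ℤ θ).eval₂ (Int.castRingHom S) τ = 0 := by
    rw [minpoly_int_eq hirr hθ, poly, eval₂_add, eval₂_add, eval₂_pow, eval₂_X, eval₂_mul, eval₂_C,
      eval₂_X, eval₂_C, eq_intCast, eq_intCast]
    exact hτ
  let L : AdjoinRoot (minpoly ℤ θ) →+* S := AdjoinRoot.lift (Int.castRingHom S) τ hev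
  let e := minpoly.equivAdjoin hint
  have hmem : ∀ x : 𝓞 K, (x : K) ∈ Algebra.adjoin ℤ ({θ} : Set K) := mem_adjoin_theta hirr hθ h2 hsq
  let ι : 𝓞 K →+* Algebra.adjoin ℤ ({θ} : Set K) :=
    { toFun := fun x => ⟨x, hmem x⟩
      map_one' := Subtype.ext (by simp)
      map_mul' := fun x y => Subtype.ext (by simp)
      map_zero' := Subtype.ext (by simp)
      map_add' := fun x y => Subtype.ext (by simp) }
  refine ⟨(L.comp e.symm.toAlgHom.toRingHom).comp ι, ?_⟩
  have hroot : e.symm (ι (thetaInt hθ)) = AdjoinRoot.root (minpoly ℤ θ) := by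
    rw [AlgEquiv.symm_apply_eq]
    apply Subtype.ext
    change ((thetaInt hθ : 𝓞 K) : K) = ((minpoly.equivAdjoin hint (AdjoinRoot.mk (minpoly ℤ θ) X) :
      Algebra.adjoin ℤ ({θ} : Set K)) : K)
    rw [minpoly.coe_equivAdjoin, AdjoinRoot.Minpoly.coe_toAdjoin_mk_X]
    rfl
  show L (e.symm (ι (thetaInt hθ))) = τ
  rw [hroot]
  exact AdjoinRoot.lift_root hev

/-- The image of `θ` under any ring map `ψ : 𝓞 K → S` is a root of `f` in `S`. [folklore] -/
theorem map_thetaInt_root (hθ : aeval θ (poly a b) = 0) {S : Type*} [CommRing S] (ψ : 𝓞 K →+* S) :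
    ψ (thetaInt hθ) ^ 2 + (a : S) * ψ (thetaInt hθ) + (b : S) = 0 := by
  have h := congrArg ψ (thetaInt_rel hθ)
  simp only [map_add, map_mul, map_pow, map_intCast, map_zero] at h
  linear_combination h

/-- **No root, no condition** (inert or unreached primes): if `f` has no root modulo `q` there is no
ring map `𝓞 K → ℤ/q`, so the certificate condition at `q` holds vacuously. [folklore] -/
theorem cert_of_no_root (hθ : aeval θ (poly a b) = 0) {q : ℕ} (ψ : 𝓞 K →+* ZMod q)
    (h : ∀ t : ZMod q, t ^ 2 + (a : ZMod q) * t + (b : ZMod q) ≠ 0) :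
    ∃ e : 𝓞 K, ψ e = 0 ∧ Prime e :=
  absurd (map_thetaInt_root hθ ψ) (h _)

/-- **Case split over the residue of `θ`**. [folklore] -/
theorem cert_of_cases (hθ : aeval θ (poly a b) = 0) {q : ℕ} (ψ : 𝓞 K →+* ZMod q)
    (h : ∀ t : ZMod q, ψ (thetaInt hθ) = t → t ^ 2 + (a : ZMod q) * t + (b : ZMod q) = 0 →
      ∃ e : 𝓞 K, ψ e = 0 ∧ Prime e) :
    ∃ e : 𝓞 K, ψ e = 0 ∧ Prime e :=
  h _ rfl (map_thetaInt_root hθ ψ)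

omit [NumberField K] in
/-- The image of `lin hθ p q` under `ψ` with `ψ θ = t`. [folklore] -/
theorem map_lin (hθ : aeval θ (poly a b) = 0) {S : Type*} [CommRing S] (ψ : 𝓞 K →+* S) {t : S}
    (ht : ψ (thetaInt hθ) = t) (p q : ℤ) : ψ (lin hθ p q) = (p : S) + (q : S) * t := by
  simp only [lin, map_add, map_mul, map_intCast, ht]

/-- Products on the integral basis `1, θ`: `(p₁ + q₁θ)(p₂ + q₂θ)`. [folklore] -/
theorem lin_mul_lin (hθ : aeval θ (poly a b) = 0) (p₁ q₁ p₂ q₂ : ℤ) :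
    lin hθ p₁ q₁ * lin hθ p₂ q₂ =
      lin hθ (p₁ * p₂ - b * q₁ * q₂) (p₁ * q₂ + p₂ * q₁ - a * q₁ * q₂) := by
  simp only [lin]
  push_cast
  linear_combination ((q₁ : 𝓞 K) * (q₂ : 𝓞 K)) * thetaInt_rel hθ

omit [NumberField K] in
/-- Integers on the basis. [folklore] -/
theorem intCast_eq_lin (hθ : aeval θ (poly a b) = 0) (n : ℤ) : ((n : ℤ) : 𝓞 K) = lin hθ n 0 := by
  simp [lin]

omit [NumberField K] in
/-- `θ` on the basis. [folklore] -/
theorem thetaInt_eq_lin (hθ : aeval θ (poly a b) = 0) : thetaInt hθ = lin hθ 0 1 := by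
  simp [lin]

omit [NumberField K] in
/-- Negation on the basis. [folklore] -/
theorem neg_lin (hθ : aeval θ (poly a b) = 0) (p q : ℤ) : -lin hθ p q = lin hθ (-p) (-q) := by
  simp only [lin]; push_cast; ring

omit [NumberField K] in
/-- Powers on the basis, one step. [folklore] -/
theorem lin_pow_succ (hθ : aeval θ (poly a b) = 0) (p q : ℤ) (n : ℕ) :
    lin hθ p q ^ (n + 1) = lin hθ p q ^ n * lin hθ p q := pow_succ _ _

omit [NumberField K] in
/-- `(p + qθ) ^ 0 = 1 = lin 1 0` in `lin` form. [folklore] -/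
theorem lin_pow_zero (hθ : aeval θ (poly a b) = 0) (p q : ℤ) : lin hθ p q ^ 0 = lin hθ 1 0 := by
  rw [pow_zero, ← intCast_eq_lin hθ 1, Int.cast_one]

end MonicQuad

end Summit.BirchSwinnertonDyer.BirchSwinnertonDyer.Rank2Observatory.TwoDescZ2

end
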